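import Literature.AnabelianGeometry.SemiGraphs.TemperedAnabelianThm64Sub
import Literature.AnabelianGeometry.EtaleTheta.SettingModelCurve
import Literature.NumberTheory.LocalFields.PadicAbsoluteGaloisGroupInfinite
import HarnessLib

/-!
# [SemiAnbd] Thm. 6.4 sub-DAG: the step predicates T64-L01, T64-L01b, T64-L04 are SCHEMAS
# (universal closures refuted at the cell's tempered-curve inhabitant)

S. Mochizuki, *Semi-graphs of anabelioids*, Publ. RIMS **42** (2006) [SemiAnbd], Theorem 6.4 and its
proof, kurims p. 70 l. −9 – p. 71 l. 11 [cite: MochizukiSemiAnbd2006, Thm 6.4 proof p.71]; [Mzk8] =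
S. Mochizuki, *Galois sections in absolute anabelian geometry*, Nagoya Math. J. **179** (2005), Thm. 1.2
p. 5.  PROOF-ONLY companion (theorems only, no definition, no named fact) of
`TemperedAnabelianThm64Sub.lean` (abc-iut-w5-d139), written for the FROZEN FACT-LIST rows
F-2831 `TemperedCurve.GeometricIsDFG`, F-2832 `TemperedCurve.GeometricIsGaloisCompatible` and
F-2836 `TemperedCurve.ProfiniteAnabelianTheorem` (abc-iut plan/F-TRANCHES.tsv tranche 170; seat
abc-iut-w4-d025, D-0078 (C3) default duty).

The three declarations are PREDICATES on the interface datum `C : TemperedCurveHom p X Y` — the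
abstract "set of dominant morphisms `X_K → Y_L`" `C.DomHom` together with the abstract tempered-`π₁`
functor `C.pi1` (TODO-merge abc-iut-L3-t2 / abc-iut-L4-t1) — and the assembly
`TemperedCurve.temperedAnabelianTheorem_of_steps` consumes them BY NAME, per instance.  This file
records in the kernel that their UNIVERSAL CLOSURES are false, i.e. that none of them can be granted
"for all interface data": at the cell's inhabitant of the [SemiAnbd] §6 interface
`EtaleTheta.SettingModel.curve p` (abc-iut-L2-t1; `K = ℚ_p`, `Π^temp = F₂ × G_{ℚ_p}` discrete,
`Π = F̂₂ × Ĝ_{ℚ_p}`) we exhibit degenerate interface data violating each: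

* `not_geometricIsDFG_trivial` — for `C.pi1 ≡ 1` (one "dominant morphism" whose `π₁` is the trivial
  homomorphism) T64-L01 fails: the trivial subgroup is not of DFG-type in an infinite profinite
  completion (its closure `{1}` is not open);
* `not_geometricIsGaloisCompatible_trivial` — for the same `C`, T64-L01b fails: the trivial
  homomorphism lies over no `h ↦ g⁻¹ h g` (`G_{ℚ_p} ≠ 1`);
* `not_profiniteAnabelianTheorem_empty` — for `C.DomHom := Empty` (no dominant morphism at all)
  T64-L04 = [Mzk8] Thm. 1.2 fails: the identity of `Π_{X_K}` is an open Galois-compatible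
  homomorphism arising from no `f`;

whence `not_forall_geometricIsDFG`, `not_forall_geometricIsGaloisCompatible`,
`not_forall_profiniteAnabelianTheorem` (FACT-LIST reading: "universal-closure REFUTED / schema;
instance forms open" — the instance forms are the hypotheses `h01`, `h01b`, `h04` of
`temperedAnabelianTheorem_of_steps`, to be supplied at the merge by the genuine tempered-`π₁` functor,
resp. consumed BY NAME as the FACT-policy input [Mzk8] Thm. 1.2).  HONEST FRAMING: statements about
DEGENERATE interface data at the cell's consistency model only; nothing of [SemiAnbd] or [Mzk8] is
asserted or denied (their theorems concern the genuine `π₁^temp` functor, which the interface does not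
pin down); no side is taken on [IUTchIII] Cor. 3.12.  The two remaining rows of the tranche,
F-2837 `OpenDenseDOFConjugator` (Lem. 6.3 (iii) at coverings) and F-2838 `OuterDescent`, are NOT
touched: at this inhabitant they are neither refutable by degenerate data (every instance is a statement
about the dense subgroup `F₂ × G_{ℚ_p} ↪ F̂₂ × Ĝ_{ℚ_p}` itself) nor provable without the [André]-class
input Lem. 6.1 (`FreeGroupNormallyTerminalInCompletion`).
-/

noncomputable section

namespace Literature.AnabelianGeometry.SemiGraphs.TemperedCurve

open Literature.AnabelianGeometry.EtaleTheta Literature.NumberTheory.LocalFields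
open Topology

variable (p : ℕ) [Fact p.Prime]

/-! ### Conventions
The two degenerate interface data over the model curve `SettingModel.curve p` are written INLINE in the
statements (no definition is introduced): `⟨Unit, fun _ => 1⟩` — ONE "dominant morphism" whose tempered
`π₁` is the trivial homomorphism — and `⟨Empty, Empty.elim⟩` — NO dominant morphism. -/

/-! ### The model's profinite completion is infinite, so `{1}` is not open in it -/

/-- `Π^temp = F₂ × G_{ℚ_p}` of the model curve is infinite (`G_{ℚ_p}` is infinite).
[cite: MochizukiSemiAnbd2006, §6 p.69] -/
theorem infinite_piTemp_curve : Infinite (SettingModel.curve p).PiTemp := by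
  haveI : Infinite (SettingModel.Gam p) := Padic.infinite_algEquiv_algebraicClosure p
  change Infinite (SettingModel.Del × SettingModel.Gam p)
  infer_instance

/-- `Π = F̂₂ × Ĝ_{ℚ_p}` of the model curve is infinite (`Π^temp ↪ Π` is injective).
[cite: MochizukiSemiAnbd2006, §6 p.69] -/
theorem infinite_piHat_curve : Infinite (SettingModel.curve p).PiHat :=
  haveI := infinite_piTemp_curve p
  Infinite.of_injective _ (SettingModel.curve p).toHat_injective

/-- In the (compact, infinite) profinite completion `Π` of the model curve the trivial subgroup is not
open. [cite: MochizukiSemiAnbd2006, §6 p.69] -/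
theorem not_isOpen_singleton_one_piHat_curve :
    ¬ IsOpen ({1} : Set (SettingModel.curve p).PiHat) := by
  intro hopen
  haveI : CompactSpace (SettingModel.curve p).PiHat :=
    (SettingModel.curve p).isProfiniteCompletion_toHat.compactSpace
  haveI : DiscreteTopology (SettingModel.curve p).PiHat := discreteTopology_iff_isOpen_singleton_one.mpr hopen
  haveI : Finite (SettingModel.curve p).PiHat := finite_of_compact_of_discrete
  exact (infinite_piHat_curve p).not_finite ‹_›

/-! ### T64-L01 `GeometricIsDFG` is a schema -/

/-- The trivial subgroup of `Π^temp` of the model curve is NOT of DFG-type: the closure of its image in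
`Π` is `{1}`, which is not an open subgroup. [cite: MochizukiSemiAnbd2006, Def 6.2(i) p.70] -/
theorem not_isDFGType_bot_curve :
    ¬ IsDFGType (SettingModel.curve p).toHat (⊥ : Subgroup (SettingModel.curve p).PiTemp) := by
  rintro ⟨⟨U, hU, hcl⟩, -⟩
  haveI : T2Space (SettingModel.curve p).PiHat :=
    (SettingModel.curve p).isProfiniteCompletion_toHat.t2Space
  have himg : ((SettingModel.curve p).toHat '' ((⊥ : Subgroup (SettingModel.curve p).PiTemp) :
      Set (SettingModel.curve p).PiTemp)) = {1} := by
    rw [Subgroup.coe_bot, Set.image_singleton, map_one]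
  rw [himg, closure_singleton] at hcl
  exact not_isOpen_singleton_one_piHat_curve p (hcl ▸ hU)

/-- **T64-L01 fails for the degenerate datum**: with `π₁ :≡ 1`, "any `Π^temp_{X_K} → Π^temp_{Y_L}`
that arises geometrically is of DFG-type" is false at the model curve.
[cite: MochizukiSemiAnbd2006, Thm 6.4 proof p.71] -/
theorem not_geometricIsDFG_trivial : ¬ GeometricIsDFG (⟨Unit, fun _ => 1⟩ : TemperedCurveHom p (SettingModel.curve p) (SettingModel.curve p)) := by
  intro h
  have h1 : IsDFGTypeHom (SettingModel.curve p).toHat (1 : (SettingModel.curve p).PiTemp →ₜ* (SettingModel.curve p).PiTemp) := h ()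
  have hrange : (1 : (SettingModel.curve p).PiTemp →ₜ* (SettingModel.curve p).PiTemp).toMonoidHom.range = ⊥ := by
    rw [eq_bot_iff]
    rintro _ ⟨x, rfl⟩
    exact (Subgroup.mem_bot).mpr rfl
  unfold IsDFGTypeHom at h1
  rw [hrange] at h1
  exact not_isDFGType_bot_curve p h1

/-- **F-2831 is a SCHEMA**: the universal closure of `TemperedCurve.GeometricIsDFG` is false.
[cite: MochizukiSemiAnbd2006, Thm 6.4 proof p.71] -/
theorem not_forall_geometricIsDFG :
    ¬ ∀ (X Y : TemperedCurve p) (C : TemperedCurveHom p X Y), GeometricIsDFG C :=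
  fun h => not_geometricIsDFG_trivial p (h _ _ _)

/-! ### T64-L01b `GeometricIsGaloisCompatible` is a schema -/

/-- **T64-L01b fails for the degenerate datum**: the trivial homomorphism of `Π^temp = F₂ × G_{ℚ_p}`
lies over no map `h ↦ g⁻¹ h g` of `G_{ℚ_p}` (that would force `aug ≡ 1`, but `aug` is onto
`G_{ℚ_p} ≠ 1`). [cite: MochizukiSemiAnbd2006, Thm 6.4 pp.70-71] -/
theorem not_geometricIsGaloisCompatible_trivial : ¬ GeometricIsGaloisCompatible (⟨Unit, fun _ => 1⟩ : TemperedCurveHom p (SettingModel.curve p) (SettingModel.curve p)) := by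
  intro h
  obtain ⟨g, -, hg⟩ := h ()
  haveI : Infinite (GQp p) := Padic.infinite_algEquiv_algebraicClosure p
  obtain ⟨σ, hσ⟩ := exists_ne (1 : GQp p)
  -- `aug` of the model is the second projection `F₂ × G_{ℚ_p} → G_{ℚ_p}` (the identity on `Γ`)
  have h1 := hg ((1 : SettingModel.Del), (σ : SettingModel.Gam p))
  have haug : (SettingModel.curve p).aug ((1 : SettingModel.Del), (σ : SettingModel.Gam p)) = σ := rfl
  have hpi : (1 : (SettingModel.curve p).PiTemp →ₜ* (SettingModel.curve p).PiTemp)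
      ((1 : SettingModel.Del), (σ : SettingModel.Gam p)) = 1 := rfl
  rw [haug] at h1
  erw [hpi, map_one] at h1
  -- `1 = g⁻¹ σ g` forces `σ = 1`
  apply hσ
  have h2 : g⁻¹ * σ * g = 1 := h1.symm
  rw [mul_assoc, inv_mul_eq_one] at h2
  exact (mul_eq_right.mp h2.symm)

/-- **F-2832 is a SCHEMA**: the universal closure of `TemperedCurve.GeometricIsGaloisCompatible` is
false. [cite: MochizukiSemiAnbd2006, Thm 6.4 pp.70-71] -/
theorem not_forall_geometricIsGaloisCompatible :
    ¬ ∀ (X Y : TemperedCurve p) (C : TemperedCurveHom p X Y), GeometricIsGaloisCompatible C :=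
  fun h => not_geometricIsGaloisCompatible_trivial p (h _ _ _)

/-! ### T64-L04 `ProfiniteAnabelianTheorem` ([Mzk8] Thm. 1.2 on the interface) is a schema -/

/-- The identity of `Π_{X_K}` is an open, Galois-compatible (over `g = 1`) homomorphism of the
profinite completions. [cite: MochizukiSemiAnbd2006, Thm 6.4 proof p.71] -/
theorem isGaloisCompatibleOpenHatHom_id (X : TemperedCurve p) :
    IsGaloisCompatibleOpenHatHom X X (ContinuousMonoidHom.id X.PiHat) := by
  refine ⟨?_, 1, ?_, fun z => ?_⟩
  · have : Set.range (ContinuousMonoidHom.id X.PiHat) = Set.univ := Set.range_eq_univ.mpr fun x => ⟨x, rfl⟩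
    rw [this]
    exact isOpen_univ
  · rw [AlgEquiv.aut_one, show ((AlgEquiv.refl : AlgebraicClosure ℚ_[p] ≃ₐ[ℚ_[p]] AlgebraicClosure ℚ_[p]) :
        AlgebraicClosure ℚ_[p] →ₐ[ℚ_[p]] AlgebraicClosure ℚ_[p]) = AlgHom.id ℚ_[p] _ from rfl,
      IntermediateField.map_id]
  · simp

/-- **T64-L04 fails for the degenerate datum**: with NO dominant morphism, the surjectivity half of
[Mzk8] Thm. 1.2 read on the interface ("every open Galois-compatible `Φ` comes from some dominant `f`")
fails at `Φ = id`. [cite: MochizukiSemiAnbd2006, Thm 6.4 proof p.71] -/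
theorem not_profiniteAnabelianTheorem_empty : ¬ ProfiniteAnabelianTheorem (⟨Empty, Empty.elim⟩ : TemperedCurveHom p (SettingModel.curve p) (SettingModel.curve p)) := by
  rintro ⟨hsurj, -⟩
  obtain ⟨f, -⟩ := hsurj _ (isGaloisCompatibleOpenHatHom_id p (SettingModel.curve p))
  exact f.elim

/-- **F-2836 is a SCHEMA**: the universal closure of `TemperedCurve.ProfiniteAnabelianTheorem` is
false (the FACT-policy input [Mzk8] Thm. 1.2 can only be granted PER INSTANCE of the interface datum,
never for all `C`). [cite: MochizukiSemiAnbd2006, Thm 6.4 proof p.71] -/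
theorem not_forall_profiniteAnabelianTheorem :
    ¬ ∀ (X Y : TemperedCurve p) (C : TemperedCurveHom p X Y), ProfiniteAnabelianTheorem C :=
  fun h => not_profiniteAnabelianTheorem_empty p (h _ _ _)

end Literature.AnabelianGeometry.SemiGraphs.TemperedCurve

end
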